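import Mathlib
import HarnessLib
import Literature.Analysis.FluidPDE.ClassicalSolutionRegion
import Summits.NavierStokesRegularity.NavierStokesRegularity.Theorems.PoloidalWindowDoorPoloidalWindowRigidityZShockSlopeFunctionPatching
import Summits.NavierStokesRegularity.NavierStokesRegularity.Theorems.PoloidalWindowDoorPoloidalWindowRigidityLocalFrozenLaw
import Summits.NavierStokesRegularity.NavierStokesRegularity.Theorems.PoloidalWindowDoorPoloidalWindowRigidityWindow
import Summits.NavierStokesRegularity.NavierStokesRegularity.Theorems.AdaptedFrequencyTangentFlowTransferAncientPressure

/-!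
# Crux K2 `PoloidalWindowRigidity` (stmt-NavierStokesRegularity-19708), line `z_shock` — L0 ASSEMBLED: THE LOCAL AUTONOMY CLAUSE OF
# `stub_zShockThickAut` PROPAGATES ALONG THE SLICE (both horizontal components, one slope function)

`--supports stmt-NavierStokesRegularity-19708 --as helper` (leafhand-ns-poloidalwindowdoor-2 g0, 2026-08-31).  **No stub and no summit is
closed by this file; Navier–Stokes regularity is NOT proved here.**

The deciding stub's autonomy clause is `∃ g W₁ ∋ z₀, ∀ z ∈ W₁, ∀ b ≠ 2, ∂_z v_b = g(t, v₂)·∂_b v₂` — ONE `g` for BOTH horizontal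
components, LOCALLY at `z₀`.  L0 = its globalisation along the analytic slice `t₀ = z₀.1` (card `Lines/z_shock.md` §«First lemma of R3»).
Tree so far: L0(a) `…ZShockAutonomyGlobal` (minors of `(D_b, ∇v₂)` vanish on the whole slice, each `b`), L0(b) local
`…ZShockSlopeFunctionLocal` (a slope function `g_x` near every point with `∂_b v₂ ≠ 0`, each `b`) and L0(b) regional
`…ZShockSlopeFunctionPatching` (one `g̃` on regions with preconnected level sets, each `b`).  This file puts the two components together
using the (M)-frozen WEDGE LAW `∂_z v₀·∂₁v₂ = ∂_z v₁·∂₀v₂` (tree `…LocalFrozenLaw.vertShear_wedge_horizGrad_eq_zero`, the `e₃`-component of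
the vorticity equation of a poloidal classical solution; for the class via the slab pressure `exists_isClassicalNSSolutionOn_Iio_of_isTypeIAncientMild`
and `…Window.isTypeIAncientMild_of_class`) and states L0 in the stub's own format:

* `slope_both_of_wedge_near` — class-free, analytic slice `f`: wedge law + vanishing minors for `b = 0, 1` ⇒ near every point `x` with
  `∇ₕf₂(x) ≠ 0` ONE `g_x` serves both components: `∂_z f_b = g_x(f₂)·∂_b f₂` on an open `U ∋ x`, `b = 0, 1`;
* `slope_both_of_wedge_on` — the same on any `Ω ⊆ {∇ₕf₂ ≠ 0}` with preconnected level sets of `f₂`: ONE `g̃` on `Ω`, both `b`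
  (patch the common slope `Λ = (∂_z v₀∂₀v₂ + ∂_z v₁∂₁v₂)/|∇ₕv₂|²`);
* `autonomy_near_of_class_autonomy` — **L0 for the class, local-everywhere form**: class binders of the stub (Type-I rate, continuity,
  Oseen identity, divergence-free, poloidal) + the local autonomy clause at `z₀` ⇒ the SAME clause (fresh `g_x`, open `U ∋ x`) at every
  point `x` of the slice with `∇ₕv₂(t₀,x) ≠ 0`;
* `autonomy_on_of_class_autonomy` — **L0 for the class, regional form**: one `g̃` on every `Ω ⊆ {∇ₕv₂(t₀,·) ≠ 0}` whose `v₂`-level sets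
  are preconnected.

What remains of the card's «globalisation» is exactly L0(c): ONE `g̃` for the whole slice may fail only through multi-valuedness across
different connected components of level sets `{v₂(t₀,·) = c} ∩ {∇ₕv₂ ≠ 0}` (the card hands this to a slice-global re-typing of the stub or
to the residue side).  presearch: as for the companions (elementary; nothing in print/Mathlib to cite). [folklore]
-/

noncomputable section

namespace Summit.NavierStokesRegularity.NavierStokesRegularity.Theorems.PoloidalWindowDoorPoloidalWindowRigidityZShockAutonomyPropagation

-- the problem directory repeats the summit name (`NavierStokesRegularity/NavierStokesRegularity`)
set_option linter.dupNamespace false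

open Set Filter Topology Function
open Literature.Analysis Literature.Analysis.FluidPDE
open Summit.NavierStokesRegularity.NavierStokesRegularity.Theorems.PoloidalWindowDoorPoloidalWindowRigidityZShockSlopeFunctionLocal
open Summit.NavierStokesRegularity.NavierStokesRegularity.Theorems.PoloidalWindowDoorPoloidalWindowRigidityZShockSlopeFunctionPatching
open Summit.NavierStokesRegularity.NavierStokesRegularity.Theorems.PoloidalWindowDoorPoloidalWindowRigidityZShockAutonomyGlobal
open Summit.NavierStokesRegularity.NavierStokesRegularity.Theorems.PoloidalWindowDoorPoloidalWindowRigidityHorizontalSourceGauge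
  (analyticOnNhd_fderiv_apply_coord)
open Summit.NavierStokesRegularity.NavierStokesRegularity.Theorems.PoloidalWindowDoorPoloidalWindowRigidityLocalFrozenLaw
  (vertShear_wedge_horizGrad_eq_zero)
open Summit.NavierStokesRegularity.NavierStokesRegularity.Theorems.PoloidalWindowDoorPoloidalWindowRigidityWindow
  (isTypeIAncientMild_of_class)

/-! ## Class-free: both components from the wedge law -/

/-- `b ≠ 2` in `Fin 3` means `b = 0` or `b = 1`. -/
theorem eq_zero_or_eq_one_of_ne_two {b : Fin 3} (hb : b ≠ 2) : b = 0 ∨ b = 1 := by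
  fin_cases b
  · exact Or.inl rfl
  · exact Or.inr rfl
  · exact absurd rfl hb

/-- **One slope function for both horizontal components, locally.**  Analytic `f : ℝ³ → ℝ³` with the wedge law
`∂_z f₀·∂₁f₂ − ∂_z f₁·∂₀f₂ = 0` everywhere and vanishing minors of `(∂_b f₂·∇(∂_z f_b) − ∂_z f_b·∇(∂_b f₂), ∇f₂)` for `b = 0, 1`
(L0(a)): near every `x` with `∇ₕf₂(x) ≠ 0` there are an open `U ∋ x` and `g : ℝ → ℝ` with `∂_z f_b = g(f₂)·∂_b f₂` on `U` for every
`b ≠ 2`. [folklore] -/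
theorem slope_both_of_wedge_near {f : EuclideanSpace ℝ (Fin 3) → EuclideanSpace ℝ (Fin 3)}
    (hf : AnalyticOnNhd ℝ f univ)
    (hwedge : ∀ x : EuclideanSpace ℝ (Fin 3),
      fderiv ℝ f x (EuclideanSpace.single 2 1) 0 * fderiv ℝ f x (EuclideanSpace.single 1 1) 2 -
        fderiv ℝ f x (EuclideanSpace.single 2 1) 1 * fderiv ℝ f x (EuclideanSpace.single 0 1) 2 = 0)
    (hminor : ∀ b : Fin 3, b ≠ 2 → ∀ x u u' : EuclideanSpace ℝ (Fin 3),
      (fderiv ℝ f x (EuclideanSpace.single b 1) 2 *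
            fderiv ℝ (fun y => fderiv ℝ f y (EuclideanSpace.single 2 1) b) x u -
          fderiv ℝ f x (EuclideanSpace.single 2 1) b *
            fderiv ℝ (fun y => fderiv ℝ f y (EuclideanSpace.single b 1) 2) x u) *
          fderiv ℝ (fun y => f y 2) x u' -
        (fderiv ℝ f x (EuclideanSpace.single b 1) 2 *
            fderiv ℝ (fun y => fderiv ℝ f y (EuclideanSpace.single 2 1) b) x u' -
          fderiv ℝ f x (EuclideanSpace.single 2 1) b *
            fderiv ℝ (fun y => fderiv ℝ f y (EuclideanSpace.single b 1) 2) x u') *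
          fderiv ℝ (fun y => f y 2) x u = 0)
    {x : EuclideanSpace ℝ (Fin 3)}
    (hx : fderiv ℝ f x (EuclideanSpace.single 0 1) 2 ≠ 0 ∨ fderiv ℝ f x (EuclideanSpace.single 1 1) 2 ≠ 0) :
    ∃ g : ℝ → ℝ, ∃ U : Set (EuclideanSpace ℝ (Fin 3)), IsOpen U ∧ x ∈ U ∧
      ∀ x' ∈ U, ∀ b : Fin 3, b ≠ 2 → fderiv ℝ f x' (EuclideanSpace.single 2 1) b =
        g (f x' 2) * fderiv ℝ f x' (EuclideanSpace.single b 1) 2 := by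
  -- continuity of the two horizontal gradient entries
  have hDc : ∀ c : Fin 3, Continuous fun y => fderiv ℝ f y (EuclideanSpace.single c 1) 2 := fun c =>
    (analyticOnNhd_fderiv_apply_coord hf _ _).continuous
  rcases hx with h0 | h1
  · -- `∂₀f₂(x) ≠ 0`: slope function for `b = 0`, transported to `b = 1` by the wedge law
    obtain ⟨g, U, hU, hxU, hgU⟩ := exists_slope_function_near_of_analytic hf (hminor 0 (by decide)) h0
    refine ⟨g, U ∩ {y | fderiv ℝ f y (EuclideanSpace.single 0 1) 2 ≠ 0},
      hU.inter (isOpen_ne_fun (hDc 0) continuous_const), ⟨hxU, h0⟩, fun x' hx' b hb => ?_⟩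
    rcases eq_zero_or_eq_one_of_ne_two hb with rfl | rfl
    · exact hgU x' hx'.1
    · have hw := hwedge x'
      have h0' : fderiv ℝ f x' (EuclideanSpace.single 0 1) 2 ≠ 0 := hx'.2
      have hg0 := hgU x' hx'.1
      -- `N₁ = N₀ D₁ / D₀ = g D₁`
      have : fderiv ℝ f x' (EuclideanSpace.single 2 1) 1 * fderiv ℝ f x' (EuclideanSpace.single 0 1) 2 =
          g (f x' 2) * fderiv ℝ f x' (EuclideanSpace.single 1 1) 2 * fderiv ℝ f x' (EuclideanSpace.single 0 1) 2 := by
        linear_combination (-1 : ℝ) * hw + fderiv ℝ f x' (EuclideanSpace.single 1 1) 2 * hg0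
      exact mul_right_cancel₀ h0' this
  · -- `∂₁f₂(x) ≠ 0`: symmetric
    obtain ⟨g, U, hU, hxU, hgU⟩ := exists_slope_function_near_of_analytic hf (hminor 1 (by decide)) h1
    refine ⟨g, U ∩ {y | fderiv ℝ f y (EuclideanSpace.single 1 1) 2 ≠ 0},
      hU.inter (isOpen_ne_fun (hDc 1) continuous_const), ⟨hxU, h1⟩, fun x' hx' b hb => ?_⟩
    rcases eq_zero_or_eq_one_of_ne_two hb with rfl | rfl
    · have hw := hwedge x'
      have h1' : fderiv ℝ f x' (EuclideanSpace.single 1 1) 2 ≠ 0 := hx'.2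
      have hg1 := hgU x' hx'.1
      have : fderiv ℝ f x' (EuclideanSpace.single 2 1) 0 * fderiv ℝ f x' (EuclideanSpace.single 1 1) 2 =
          g (f x' 2) * fderiv ℝ f x' (EuclideanSpace.single 0 1) 2 * fderiv ℝ f x' (EuclideanSpace.single 1 1) 2 := by
        linear_combination hw + fderiv ℝ f x' (EuclideanSpace.single 0 1) 2 * hg1
      exact mul_right_cancel₀ h1' this
    · exact hgU x' hx'.1

/-- **One slope function for both components on a region with connected level sets.**  Under the hypotheses of
`slope_both_of_wedge_near`, on every `Ω ⊆ {∇ₕf₂ ≠ 0}` whose level sets `Ω ∩ {f₂ = c}` are preconnected there is ONE `g̃ : ℝ → ℝ` with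
`∂_z f_b = g̃(f₂)·∂_b f₂` on `Ω` for every `b ≠ 2` (patch the common slope `Λ = (∂_z f₀∂₀f₂ + ∂_z f₁∂₁f₂)/|∇ₕf₂|²`). [folklore] -/
theorem slope_both_of_wedge_on {f : EuclideanSpace ℝ (Fin 3) → EuclideanSpace ℝ (Fin 3)}
    (hf : AnalyticOnNhd ℝ f univ)
    (hwedge : ∀ x : EuclideanSpace ℝ (Fin 3),
      fderiv ℝ f x (EuclideanSpace.single 2 1) 0 * fderiv ℝ f x (EuclideanSpace.single 1 1) 2 -
        fderiv ℝ f x (EuclideanSpace.single 2 1) 1 * fderiv ℝ f x (EuclideanSpace.single 0 1) 2 = 0)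
    (hminor : ∀ b : Fin 3, b ≠ 2 → ∀ x u u' : EuclideanSpace ℝ (Fin 3),
      (fderiv ℝ f x (EuclideanSpace.single b 1) 2 *
            fderiv ℝ (fun y => fderiv ℝ f y (EuclideanSpace.single 2 1) b) x u -
          fderiv ℝ f x (EuclideanSpace.single 2 1) b *
            fderiv ℝ (fun y => fderiv ℝ f y (EuclideanSpace.single b 1) 2) x u) *
          fderiv ℝ (fun y => f y 2) x u' -
        (fderiv ℝ f x (EuclideanSpace.single b 1) 2 *
            fderiv ℝ (fun y => fderiv ℝ f y (EuclideanSpace.single 2 1) b) x u' -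
          fderiv ℝ f x (EuclideanSpace.single 2 1) b *
            fderiv ℝ (fun y => fderiv ℝ f y (EuclideanSpace.single b 1) 2) x u') *
          fderiv ℝ (fun y => f y 2) x u = 0)
    {Ω : Set (EuclideanSpace ℝ (Fin 3))}
    (hΩ : ∀ x ∈ Ω, fderiv ℝ f x (EuclideanSpace.single 0 1) 2 ≠ 0 ∨ fderiv ℝ f x (EuclideanSpace.single 1 1) 2 ≠ 0)
    (hconn : ∀ c : ℝ, IsPreconnected (Ω ∩ (fun y => f y 2) ⁻¹' {c})) :
    ∃ g : ℝ → ℝ, ∀ x ∈ Ω, ∀ b : Fin 3, b ≠ 2 → fderiv ℝ f x (EuclideanSpace.single 2 1) b =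
      g (f x 2) * fderiv ℝ f x (EuclideanSpace.single b 1) 2 := by
  -- shorthand
  set N0 : EuclideanSpace ℝ (Fin 3) → ℝ := fun y => fderiv ℝ f y (EuclideanSpace.single 2 1) 0 with hN0
  set N1 : EuclideanSpace ℝ (Fin 3) → ℝ := fun y => fderiv ℝ f y (EuclideanSpace.single 2 1) 1 with hN1
  set D0 : EuclideanSpace ℝ (Fin 3) → ℝ := fun y => fderiv ℝ f y (EuclideanSpace.single 0 1) 2 with hD0
  set D1 : EuclideanSpace ℝ (Fin 3) → ℝ := fun y => fderiv ℝ f y (EuclideanSpace.single 1 1) 2 with hD1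
  -- the common slope
  set Λ : EuclideanSpace ℝ (Fin 3) → ℝ := fun y => (N0 y * D0 y + N1 y * D1 y) / (D0 y ^ 2 + D1 y ^ 2) with hΛ
  have hpos : ∀ x ∈ Ω, D0 x ^ 2 + D1 x ^ 2 ≠ 0 := by
    intro x hx
    rcases hΩ x hx with h | h
    · have : 0 < D0 x ^ 2 := by positivity
      positivity
    · have : 0 < D1 x ^ 2 := by positivity
      positivity
  -- where `N_b = g D_b` for both `b`, `Λ = g`
  have hΛeq : ∀ (x : EuclideanSpace ℝ (Fin 3)) (c : ℝ), D0 x ^ 2 + D1 x ^ 2 ≠ 0 →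
      N0 x = c * D0 x → N1 x = c * D1 x → Λ x = c := by
    intro x c hx h0 h1
    simp only [hΛ, h0, h1]
    field_simp
  -- `Λ` is locally a function of `w` at points of `Ω` (within `Ω`)
  have hloc : ∀ x ∈ Ω, ∃ g : ℝ → ℝ, ∀ᶠ x' in 𝓝[Ω] x, Λ x' = g (f x' 2) := by
    intro x hx
    obtain ⟨g, U, hU, hxU, hgU⟩ := slope_both_of_wedge_near hf hwedge hminor (hΩ x hx)
    refine ⟨g, ?_⟩
    filter_upwards [nhdsWithin_le_nhds (hU.mem_nhds hxU), self_mem_nhdsWithin] with x' hx'U hx'Ω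
    exact hΛeq x' (g (f x' 2)) (hpos x' hx'Ω) (hgU x' hx'U 0 (by decide)) (hgU x' hx'U 1 (by decide))
  obtain ⟨G, hG⟩ := exists_comp_eq_on_of_local hloc hconn
  refine ⟨G, fun x hx b hb => ?_⟩
  -- at `x`: `N_b = g_x D_b` with the local `g_x`, and `Λ x = g_x (w x) = G (w x)`
  obtain ⟨g, U, hU, hxU, hgU⟩ := slope_both_of_wedge_near hf hwedge hminor (hΩ x hx)
  have hΛx : Λ x = g (f x 2) := hΛeq x _ (hpos x hx) (hgU x hxU 0 (by decide)) (hgU x hxU 1 (by decide))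
  rw [← hG x hx, hΛx]
  exact hgU x hxU b hb

/-! ## Class level: the local autonomy clause propagates along the slice -/

/-- **L0 (local-everywhere form) for the route's class.**  Let `v` carry the class binders of `stub_zShockThickAut` (Type-I time rate,
continuity on the open backward slab, unit-viscosity Oseen identity between negative times, divergence-free and poloidal slices) and the
stub's LOCAL autonomy clause at a point `z₀` of an open `W₁` inside the slab.  Then at EVERY point `x` of the slice `t₀ = z₀.1` with
`∇ₕv₂(t₀, x) ≠ 0` the same clause holds afresh: there are an open `U ∋ x` and `g_x : ℝ → ℝ` with `∂_z v_b = g_x(v₂)·∂_b v₂` on `U`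
for every `b ≠ 2`.  Ingredients: slice analyticity, L0(a) (`minors_eq_zero_of_class_autonomy`), L0(b) local
(`exists_slope_function_near_of_analytic`) and the wedge law of the poloidal classical solution on the slab. [folklore] -/
theorem autonomy_near_of_class_autonomy (C : ℝ) (v : ℝ → EuclideanSpace ℝ (Fin 3) → EuclideanSpace ℝ (Fin 3))
    (hrate : Literature.Analysis.FluidPDE.HasTypeITimeDecay C v)
    (hcont : ContinuousOn (Function.uncurry v) (Set.Iio (0 : ℝ) ×ˢ Set.univ))
    (hmild : ∀ s t : ℝ, s < t → t < 0 → ∀ x, v t x =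
      Literature.Analysis.UnboundedOperators.heatExtension (v s) (t - s) x -
        Literature.Analysis.FluidPDE.oseenDuhamel 1 s v v t x)
    (hdiv : ∀ t < 0, Literature.Analysis.FluidPDE.VectorCalculus.IsDivFree (v t))
    (hpol : ∀ s < 0, ∀ y, inner ℝ (Literature.Analysis.FluidPDE.curl (v s) y) (EuclideanSpace.single 2 1) = 0)
    {W₁ : Set (ℝ × EuclideanSpace ℝ (Fin 3))} (hW₁ : IsOpen W₁) (hW₁s : W₁ ⊆ Set.Iio (0 : ℝ) ×ˢ Set.univ)
    {z₀ : ℝ × EuclideanSpace ℝ (Fin 3)} (hz₀ : z₀ ∈ W₁) {g : ℝ → ℝ → ℝ}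
    (haut : ∀ z ∈ W₁, ∀ b : Fin 3, b ≠ 2 →
      fderiv ℝ (v z.1) z.2 (EuclideanSpace.single 2 1) b =
        g z.1 (v z.1 z.2 2) * fderiv ℝ (v z.1) z.2 (EuclideanSpace.single b 1) 2)
    {x : EuclideanSpace ℝ (Fin 3)}
    (hx : fderiv ℝ (v z₀.1) x (EuclideanSpace.single 0 1) 2 ≠ 0 ∨ fderiv ℝ (v z₀.1) x (EuclideanSpace.single 1 1) 2 ≠ 0) :
    ∃ gx : ℝ → ℝ, ∃ U : Set (EuclideanSpace ℝ (Fin 3)), IsOpen U ∧ x ∈ U ∧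
      ∀ x' ∈ U, ∀ b : Fin 3, b ≠ 2 → fderiv ℝ (v z₀.1) x' (EuclideanSpace.single 2 1) b =
        gx (v z₀.1 x' 2) * fderiv ℝ (v z₀.1) x' (EuclideanSpace.single b 1) 2 := by
  have ht₀ : z₀.1 < 0 := (Set.mem_prod.1 (hW₁s hz₀)).1
  -- slice analyticity
  have hbdd : ∀ δ : ℝ, 0 < δ → ∃ B : ℝ, ∀ t < -δ, ∀ y : EuclideanSpace ℝ (Fin 3), ‖v t y‖ ≤ B := by
    intro δ hδ
    refine ⟨|C| / Real.sqrt δ, fun t ht y => ?_⟩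
    have hδt : δ ≤ -t := by linarith
    have hsq : Real.sqrt δ ≤ Real.sqrt (-t) := Real.sqrt_le_sqrt hδt
    have hsqpos : 0 < Real.sqrt δ := Real.sqrt_pos.2 hδ
    calc ‖v t y‖ ≤ C / Real.sqrt (-t) := hrate t (by linarith) y
      _ ≤ |C| / Real.sqrt (-t) := by gcongr; exact le_abs_self C
      _ ≤ |C| / Real.sqrt δ := by gcongr
  have han : AnalyticOnNhd ℝ (v z₀.1) univ :=
    Literature.Analysis.NavierStokesZoomKit.LocalSineTubeDoorProfileAlignedWindowRigidityAncient.analyticOnNhd_slice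
      hcont hbdd hmild ht₀
  -- the wedge law on the slab (poloidal classical solution with the slab pressure)
  obtain ⟨q, hq⟩ := exists_isClassicalNSSolutionOn_Iio_of_isTypeIAncientMild (isTypeIAncientMild_of_class hrate hcont hmild hdiv)
  have hslab : IsOpen (Set.Iio (0 : ℝ) ×ˢ (Set.univ : Set (EuclideanSpace ℝ (Fin 3)))) := isOpen_Iio.prod isOpen_univ
  have hpol' : ∀ p ∈ Set.Iio (0 : ℝ) ×ˢ (Set.univ : Set (EuclideanSpace ℝ (Fin 3))),
      inner ℝ (curl (v p.1) p.2) (EuclideanSpace.single 2 (1 : ℝ)) = 0 :=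
    fun p hp => hpol p.1 (Set.mem_prod.1 hp).1 p.2
  have hwedge : ∀ y : EuclideanSpace ℝ (Fin 3),
      fderiv ℝ (v z₀.1) y (EuclideanSpace.single 2 1) 0 * fderiv ℝ (v z₀.1) y (EuclideanSpace.single 1 1) 2 -
        fderiv ℝ (v z₀.1) y (EuclideanSpace.single 2 1) 1 * fderiv ℝ (v z₀.1) y (EuclideanSpace.single 0 1) 2 = 0 :=
    fun y => vertShear_wedge_horizGrad_eq_zero hslab hq.onRegion hpol' (p := (z₀.1, y)) (Set.mk_mem_prod ht₀ (Set.mem_univ y))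
  exact slope_both_of_wedge_near han hwedge
    (fun b hb y u u' => minors_eq_zero_of_class_autonomy C v hrate hcont hmild hW₁ hW₁s hz₀ haut hb y u u') hx

/-- **L0 (regional form) for the route's class.**  Under the same binders and the local autonomy clause at `z₀`, on every set `Ω` of the
slice `t₀ = z₀.1` on which `∇ₕv₂(t₀,·) ≠ 0` and whose `v₂(t₀,·)`-level sets are preconnected, ONE slope function serves both horizontal
components: `∂_z v_b = g̃(v₂)·∂_b v₂` on `Ω`, `b ≠ 2`.  (L0(c) — one `g̃` for the whole slice — can fail only by multi-valuedness across
different components of a level set; not addressed.) [folklore] -/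
theorem autonomy_on_of_class_autonomy (C : ℝ) (v : ℝ → EuclideanSpace ℝ (Fin 3) → EuclideanSpace ℝ (Fin 3))
    (hrate : Literature.Analysis.FluidPDE.HasTypeITimeDecay C v)
    (hcont : ContinuousOn (Function.uncurry v) (Set.Iio (0 : ℝ) ×ˢ Set.univ))
    (hmild : ∀ s t : ℝ, s < t → t < 0 → ∀ x, v t x =
      Literature.Analysis.UnboundedOperators.heatExtension (v s) (t - s) x -
        Literature.Analysis.FluidPDE.oseenDuhamel 1 s v v t x)
    (hdiv : ∀ t < 0, Literature.Analysis.FluidPDE.VectorCalculus.IsDivFree (v t))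
    (hpol : ∀ s < 0, ∀ y, inner ℝ (Literature.Analysis.FluidPDE.curl (v s) y) (EuclideanSpace.single 2 1) = 0)
    {W₁ : Set (ℝ × EuclideanSpace ℝ (Fin 3))} (hW₁ : IsOpen W₁) (hW₁s : W₁ ⊆ Set.Iio (0 : ℝ) ×ˢ Set.univ)
    {z₀ : ℝ × EuclideanSpace ℝ (Fin 3)} (hz₀ : z₀ ∈ W₁) {g : ℝ → ℝ → ℝ}
    (haut : ∀ z ∈ W₁, ∀ b : Fin 3, b ≠ 2 →
      fderiv ℝ (v z.1) z.2 (EuclideanSpace.single 2 1) b =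
        g z.1 (v z.1 z.2 2) * fderiv ℝ (v z.1) z.2 (EuclideanSpace.single b 1) 2)
    {Ω : Set (EuclideanSpace ℝ (Fin 3))}
    (hΩ : ∀ x ∈ Ω, fderiv ℝ (v z₀.1) x (EuclideanSpace.single 0 1) 2 ≠ 0 ∨
      fderiv ℝ (v z₀.1) x (EuclideanSpace.single 1 1) 2 ≠ 0)
    (hconn : ∀ c : ℝ, IsPreconnected (Ω ∩ (fun y => v z₀.1 y 2) ⁻¹' {c})) :
    ∃ gΩ : ℝ → ℝ, ∀ x ∈ Ω, ∀ b : Fin 3, b ≠ 2 → fderiv ℝ (v z₀.1) x (EuclideanSpace.single 2 1) b =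
      gΩ (v z₀.1 x 2) * fderiv ℝ (v z₀.1) x (EuclideanSpace.single b 1) 2 := by
  have ht₀ : z₀.1 < 0 := (Set.mem_prod.1 (hW₁s hz₀)).1
  have hbdd : ∀ δ : ℝ, 0 < δ → ∃ B : ℝ, ∀ t < -δ, ∀ y : EuclideanSpace ℝ (Fin 3), ‖v t y‖ ≤ B := by
    intro δ hδ
    refine ⟨|C| / Real.sqrt δ, fun t ht y => ?_⟩
    have hδt : δ ≤ -t := by linarith
    have hsq : Real.sqrt δ ≤ Real.sqrt (-t) := Real.sqrt_le_sqrt hδt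
    have hsqpos : 0 < Real.sqrt δ := Real.sqrt_pos.2 hδ
    calc ‖v t y‖ ≤ C / Real.sqrt (-t) := hrate t (by linarith) y
      _ ≤ |C| / Real.sqrt (-t) := by gcongr; exact le_abs_self C
      _ ≤ |C| / Real.sqrt δ := by gcongr
  have han : AnalyticOnNhd ℝ (v z₀.1) univ :=
    Literature.Analysis.NavierStokesZoomKit.LocalSineTubeDoorProfileAlignedWindowRigidityAncient.analyticOnNhd_slice
      hcont hbdd hmild ht₀
  obtain ⟨q, hq⟩ := exists_isClassicalNSSolutionOn_Iio_of_isTypeIAncientMild (isTypeIAncientMild_of_class hrate hcont hmild hdiv)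
  have hslab : IsOpen (Set.Iio (0 : ℝ) ×ˢ (Set.univ : Set (EuclideanSpace ℝ (Fin 3)))) := isOpen_Iio.prod isOpen_univ
  have hpol' : ∀ p ∈ Set.Iio (0 : ℝ) ×ˢ (Set.univ : Set (EuclideanSpace ℝ (Fin 3))),
      inner ℝ (curl (v p.1) p.2) (EuclideanSpace.single 2 (1 : ℝ)) = 0 :=
    fun p hp => hpol p.1 (Set.mem_prod.1 hp).1 p.2
  have hwedge : ∀ y : EuclideanSpace ℝ (Fin 3),
      fderiv ℝ (v z₀.1) y (EuclideanSpace.single 2 1) 0 * fderiv ℝ (v z₀.1) y (EuclideanSpace.single 1 1) 2 -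
        fderiv ℝ (v z₀.1) y (EuclideanSpace.single 2 1) 1 * fderiv ℝ (v z₀.1) y (EuclideanSpace.single 0 1) 2 = 0 :=
    fun y => vertShear_wedge_horizGrad_eq_zero hslab hq.onRegion hpol' (p := (z₀.1, y)) (Set.mk_mem_prod ht₀ (Set.mem_univ y))
  exact slope_both_of_wedge_on han hwedge
    (fun b hb y u u' => minors_eq_zero_of_class_autonomy C v hrate hcont hmild hW₁ hW₁s hz₀ haut hb y u u') hΩ hconn

end Summit.NavierStokesRegularity.NavierStokesRegularity.Theorems.PoloidalWindowDoorPoloidalWindowRigidityZShockAutonomyPropagation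

end
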